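import Literature.Probability.LatticeModels.VillainCurrentDuality
import HarnessLib

/-!
# Deleting bonds decreases the worm two-point function of the Villain current model

Ginibre's monotonicity in the VOLUME (Aizenman–Harel–Peled–Shapiro 2021, Cor. 11.4: "monotone in
the coupling constants along each edge, and hence in the volume of the system") on the current
side of the duality, for the bondwise-stiffness Villain integer-current model
`VillainCurrentModel d L M` of `VillainCurrentModel.lean`: for every set `D` of bonds of the
space-time torus and all space-time sites `x, y`,

  `(∑_{J : div J = δ_x − δ_y, J|_D = 0} W(J)) / (∑_{J : div J = 0, J|_D = 0} W(J)) ≤ twoPoint P x y`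

(`VillainCurrentModel.restrictedCurrentSum_div_le_twoPoint`): the worm two-point function of the
model with the bonds of `D` DELETED (currents forced to vanish there; the weights of the deleted
bonds are then `e^0 = 1`, so `W` may be taken to be the weight of `P`) is at most that of `P`.
Proof: lower the stiffness of the bonds of `D` to `ε` (Ginibre/AHPS monotonicity on the current
side, `VillainCurrentModel.twoPoint_mono` of `VillainCurrentDuality.lean`), and let `ε → 0⁺`:
a configuration with a non-zero current on `D` has `ε`-weight at most
`e^{1/(2κ₀)} e^{-1/(2ε)} ≤ 2ε e^{1/(2κ₀)}` times its `P`-weight (`κ₀` a lower bound of the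
stiffnesses), so the `ε`-partition function exceeds the deleted one by at most `O(ε) · ∑_J W(J)`
(`currentSum_lowered_le`), while the `ε`-numerator dominates the deleted numerator.

This is the lemma by which the equal-time two-point function of a `(d+1)`-dimensional model
dominates that of its time-slice (`SliceMonotonicity` of route BECVortexSheetPeierls) and a torus
dominates its sub-boxes. Everything is PROVED; no definition and no named fact is introduced.

## References

* [AizenmanHarelPeledShapiro2021] M. Aizenman, M. Harel, R. Peled, J. Shapiro, arXiv:2110.09498,
  §11.3, Cor. 11.4 (monotonicity in the couplings "and hence in the volume").
* [Ginibre1970] J. Ginibre, Comm. Math. Phys. 16 (1970) 310–328.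
-/

noncomputable section

open Finset Filter
open scoped ENNReal BigOperators NNReal

namespace Literature.Probability.LatticeModels

namespace VillainCurrentModel

open JCurrent PositiveCurrentModel

variable {d L M : ℕ} [NeZero L] [NeZero M] (P : VillainCurrentModel d L M)

/-- Weights are monotone in the stiffness, bond by bond: if `Q.stiffness ≤ P.stiffness` then
`W_Q(J) ≤ W_P(J)` for every configuration (`e^{-J²/(2κ)}` increases with `κ > 0`). [folklore] -/
theorem weight_le_weight_of_stiffness_le (Q : VillainCurrentModel d L M)
    (h : ∀ b, Q.stiffness b ≤ P.stiffness b) (J : Config d L M) : Q.weight J ≤ P.weight J := by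
  unfold weight
  refine Finset.prod_le_prod' fun b _ => ENNReal.ofReal_le_ofReal ?_
  unfold villainCurrentWeight
  refine Real.exp_le_exp.2 ?_
  rw [neg_div, neg_div, neg_le_neg_iff]
  have hQ := Q.stiffness_pos b
  exact div_le_div_of_nonneg_left (sq_nonneg _) (by linarith) (by linarith [h b])

/-- The key domination for the deletion limit. Let `Q` agree with `P` off `D` and have stiffness
`≤ ε ≤ κ₀` on `D`, where `κ₀ ≤ P.stiffness` on `D`. Then a configuration carrying a non-zero
current on some bond of `D` has `W_Q(J) ≤ e^{1/(2κ₀)} e^{-1/(2ε)} W_P(J)`. [folklore] -/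
theorem weight_lowered_le (Q : VillainCurrentModel d L M) (D : Finset (Bond d L M)) {κ₀ ε : ℝ}
    (hε : 0 < ε) (hεκ : ε ≤ κ₀) (hκ₀ : ∀ b ∈ D, κ₀ ≤ P.stiffness b)
    (hoff : ∀ b, b ∉ D → Q.stiffness b = P.stiffness b) (hon : ∀ b ∈ D, Q.stiffness b ≤ ε)
    (J : Config d L M) {b₀ : Bond d L M} (hb₀ : b₀ ∈ D) (hJ : J b₀ ≠ 0) :
    Q.weight J ≤ ENNReal.ofReal (Real.exp (1 / (2 * κ₀)) * Real.exp (-(1 / (2 * ε)))) * P.weight J := by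
  classical
  have hκ₀pos : 0 < κ₀ := lt_of_lt_of_le hε hεκ
  -- factorwise comparison `q_b ≤ p_b`, with the gain at `b₀`
  have hfac : ∀ b, villainCurrentWeight (Q.stiffness b) (J b) ≤
      villainCurrentWeight (P.stiffness b) (J b) := by
    intro b
    by_cases hb : b ∈ D
    · unfold villainCurrentWeight
      refine Real.exp_le_exp.2 ?_
      rw [neg_div, neg_div, neg_le_neg_iff]
      have h1 : Q.stiffness b ≤ P.stiffness b := le_trans (hon b hb) (le_trans hεκ (hκ₀ b hb))
      exact div_le_div_of_nonneg_left (sq_nonneg _) (by linarith [Q.stiffness_pos b])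
        (by linarith)
    · rw [hoff b hb]
  have hgain : villainCurrentWeight (Q.stiffness b₀) (J b₀) ≤
      (Real.exp (1 / (2 * κ₀)) * Real.exp (-(1 / (2 * ε)))) *
        villainCurrentWeight (P.stiffness b₀) (J b₀) := by
    unfold villainCurrentWeight
    rw [← Real.exp_add, ← Real.exp_add]
    refine Real.exp_le_exp.2 ?_
    have hJ1 : (1 : ℝ) ≤ (J b₀ : ℝ) ^ 2 := by
      have h1 : (1 : ℤ) ≤ |J b₀| := Int.one_le_abs hJ
      have h2 : (1 : ℝ) ≤ |(J b₀ : ℝ)| := by exact_mod_cast h1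
      nlinarith [abs_nonneg (J b₀ : ℝ), sq_abs (J b₀ : ℝ)]
    have hQb : 0 < Q.stiffness b₀ := Q.stiffness_pos b₀
    have hQε : Q.stiffness b₀ ≤ ε := hon b₀ hb₀
    have hPb : κ₀ ≤ P.stiffness b₀ := hκ₀ b₀ hb₀
    -- `-J²/(2Q) ≤ 1/(2κ₀) - 1/(2ε) - J²/(2P)`
    have hA : (J b₀ : ℝ) ^ 2 / (2 * ε) ≤ (J b₀ : ℝ) ^ 2 / (2 * Q.stiffness b₀) :=
      div_le_div_of_nonneg_left (sq_nonneg _) (by linarith) (by linarith)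
    have hB : (J b₀ : ℝ) ^ 2 / (2 * P.stiffness b₀) ≤ (J b₀ : ℝ) ^ 2 / (2 * κ₀) :=
      div_le_div_of_nonneg_left (sq_nonneg _) (by linarith) (by linarith)
    have hC : (1 : ℝ) / (2 * ε) - 1 / (2 * κ₀) ≤ (J b₀ : ℝ) ^ 2 / (2 * ε) - (J b₀ : ℝ) ^ 2 / (2 * κ₀) := by
      rw [div_sub_div _ _ (by positivity) (by positivity), div_sub_div _ _ (by positivity) (by positivity)]
      refine div_le_div_of_nonneg_right ?_ (by positivity)
      nlinarith
    rw [neg_div, neg_div]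
    linarith
  -- assemble the product
  unfold weight
  rw [← Finset.mul_prod_erase Finset.univ _ (Finset.mem_univ b₀),
    ← Finset.mul_prod_erase Finset.univ (fun b => ENNReal.ofReal (villainCurrentWeight (P.stiffness b) (J b)))
      (Finset.mem_univ b₀), ← mul_assoc, ← ENNReal.ofReal_mul (by positivity)]
  refine mul_le_mul' (ENNReal.ofReal_le_ofReal hgain) ?_
  exact Finset.prod_le_prod' fun b _ => ENNReal.ofReal_le_ofReal (hfac b)

/-- **The lowered partition function is close to the deleted one.** With `Q, D, κ₀, ε` as in
`weight_lowered_le`, for every source `ρ`: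
`Z_Q(ρ) ≤ ∑_{div J = ρ, J|_D = 0} W_P(J) + (2ε e^{1/(2κ₀)}) · ∑_J W_P(J)`
(split according to whether `J` vanishes on `D`; on the second part use `weight_lowered_le` and
`e^{-1/(2ε)} ≤ 2ε`). [folklore] -/
theorem currentSum_lowered_le (Q : VillainCurrentModel d L M) (D : Finset (Bond d L M)) {κ₀ ε : ℝ}
    (hε : 0 < ε) (hεκ : ε ≤ κ₀) (hκ₀ : ∀ b ∈ D, κ₀ ≤ P.stiffness b)
    (hoff : ∀ b, b ∉ D → Q.stiffness b = P.stiffness b) (hon : ∀ b ∈ D, Q.stiffness b ≤ ε)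
    (ρ : SpaceTimeSite d L M → ℤ) :
    Q.currentSum ρ ≤
      (∑' J : Config d L M, if div J = ρ ∧ (∀ b ∈ D, J b = 0) then P.weight J else 0) +
        ENNReal.ofReal (2 * ε * Real.exp (1 / (2 * κ₀))) * ∑' J : Config d L M, P.weight J := by
  classical
  have hκ₀pos : 0 < κ₀ := lt_of_lt_of_le hε hεκ
  set c : ℝ := Real.exp (1 / (2 * κ₀)) * Real.exp (-(1 / (2 * ε))) with hc
  have hc2 : c ≤ 2 * ε * Real.exp (1 / (2 * κ₀)) := by
    rw [hc, mul_comm]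
    refine mul_le_mul_of_nonneg_right ?_ (Real.exp_pos _).le
    -- `e^{-1/(2ε)} ≤ 2ε` from `x + 1 ≤ e^x` at `x = 1/(2ε)`
    have h1 : 1 / (2 * ε) + 1 ≤ Real.exp (1 / (2 * ε)) := Real.add_one_le_exp _
    have h2 : 0 < Real.exp (1 / (2 * ε)) := Real.exp_pos _
    rw [Real.exp_neg, inv_le_comm₀ h2 (by positivity)]
    have h3 : (2 * ε)⁻¹ = 1 / (2 * ε) := (one_div _).symm
    rw [h3]
    linarith
  unfold currentSum
  rw [← ENNReal.tsum_mul_left, ← ENNReal.tsum_add]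
  refine ENNReal.tsum_le_tsum fun J => ?_
  by_cases hJ : div J = ρ
  · by_cases hD : ∀ b ∈ D, J b = 0
    · -- `J` vanishes on `D`: `W_Q(J) = W_P(J)`
      rw [if_pos hJ, if_pos ⟨hJ, hD⟩]
      have hw : Q.weight J = P.weight J := by
        unfold weight
        refine Finset.prod_congr rfl fun b _ => ?_
        by_cases hb : b ∈ D
        · rw [hD b hb, villainCurrentWeight_zero, villainCurrentWeight_zero]
        · rw [hoff b hb]
      rw [hw]
      exact le_self_add
    · -- `J` has a non-zero current on `D`
      rw [if_pos hJ, if_neg (fun h => hD h.2)]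
      obtain ⟨b₀, hb₀, hJb⟩ : ∃ b₀ ∈ D, J b₀ ≠ 0 := by
        by_contra hcon
        exact hD fun b hb => by_contra fun hJb => hcon ⟨b, hb, hJb⟩
      calc Q.weight J ≤ ENNReal.ofReal c * P.weight J :=
            P.weight_lowered_le Q D hε hεκ hκ₀ hoff hon J hb₀ hJb
        _ ≤ ENNReal.ofReal (2 * ε * Real.exp (1 / (2 * κ₀))) * P.weight J :=
            mul_le_mul' (ENNReal.ofReal_le_ofReal hc2) le_rfl
        _ ≤ _ := le_add_self
  · rw [if_neg hJ]
    exact bot_le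

/-- **Deleting bonds decreases the worm two-point function** (Ginibre monotonicity in the
volume, on the current side). For every finite set `D` of bonds of the space-time torus and all
space-time sites `x, y`: the two-point function of the model in which the bonds of `D` carry no
current,
`(∑_{div J = δ_x − δ_y, J|_D = 0} W(J)) / (∑_{div J = 0, J|_D = 0} W(J))`, is at most
`twoPoint P x y`. Proof: lower the stiffnesses on `D` to `ε ≤ min κ` — the two-point function
decreases (`twoPoint_mono`, AHPS Cor. 11.4) and stays above
`(deleted numerator)/(deleted denominator + O(ε))` (`currentSum_lowered_le`); let `ε → 0⁺`.
[cite: AizenmanHarelPeledShapiro2021, Cor. 11.4 ("and hence in the volume")] -/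
theorem restrictedCurrentSum_div_le_twoPoint (D : Finset (Bond d L M)) (x y : SpaceTimeSite d L M) :
    (∑' J : Config d L M,
        if div J = Pi.single x 1 - Pi.single y 1 ∧ (∀ b ∈ D, J b = 0) then P.weight J else 0) /
      (∑' J : Config d L M, if div J = 0 ∧ (∀ b ∈ D, J b = 0) then P.weight J else 0) ≤
      P.twoPoint x y := by
  classical
  -- a uniform positive lower bound of the stiffnesses
  haveI : Nonempty (Bond d L M) := ⟨((fun _ => 0, 0), none)⟩
  obtain ⟨bmin, -, hbmin⟩ := Finset.exists_min_image Finset.univ P.stiffness Finset.univ_nonempty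
  set κ₀ : ℝ := P.stiffness bmin with hκ₀def
  have hκ₀pos : 0 < κ₀ := P.stiffness_pos bmin
  have hκ₀ : ∀ b ∈ D, κ₀ ≤ P.stiffness b := fun b _ => hbmin b (Finset.mem_univ b)
  -- names
  set N : ℝ≥0∞ := ∑' J : Config d L M,
    if div J = Pi.single x 1 - Pi.single y 1 ∧ (∀ b ∈ D, J b = 0) then P.weight J else 0 with hN
  set Z : ℝ≥0∞ := ∑' J : Config d L M,
    if div J = 0 ∧ (∀ b ∈ D, J b = 0) then P.weight J else 0 with hZ
  set T : ℝ≥0∞ := ∑' J : Config d L M, P.weight J with hT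
  set a : ℝ≥0∞ := P.twoPoint x y with ha
  have hT : T ≠ ⊤ := P.tsum_weight_ne_top
  have ha' : a ≠ ⊤ := P.twoPoint_ne_top x y
  have hZ1 : 1 ≤ Z := by
    refine le_trans ?_ (ENNReal.le_tsum (0 : Config d L M))
    rw [if_pos ⟨div_zero, fun b _ => rfl⟩, weight_zero]
  have hZ0 : Z ≠ 0 := (lt_of_lt_of_le one_pos hZ1).ne'
  have hZtop : Z ≠ ⊤ := by
    refine ne_top_of_le_ne_top hT (ENNReal.tsum_le_tsum fun J => ?_)
    split_ifs
    · exact le_rfl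
    · exact bot_le
  -- the comparison model with stiffness `ε` on `D`
  have key : ∀ ε : ℝ, 0 < ε → ε ≤ κ₀ →
      N ≤ a * (Z + ENNReal.ofReal (2 * ε * Real.exp (1 / (2 * κ₀))) * T) := by
    intro ε hε hεκ
    let Q : VillainCurrentModel d L M :=
      ⟨fun b => if b ∈ D then ε else P.stiffness b, fun b => by
        split_ifs
        · exact hε
        · exact P.stiffness_pos b⟩
    have hoff : ∀ b, b ∉ D → Q.stiffness b = P.stiffness b := fun b hb => by
      show (if b ∈ D then ε else P.stiffness b) = _
      rw [if_neg hb]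
    have hon : ∀ b ∈ D, Q.stiffness b ≤ ε := fun b hb => by
      show (if b ∈ D then ε else P.stiffness b) ≤ ε
      rw [if_pos hb]
    have hQP : ∀ b, Q.stiffness b ≤ P.stiffness b := fun b => by
      by_cases hb : b ∈ D
      · exact le_trans (hon b hb) (le_trans hεκ (hκ₀ b hb))
      · exact (hoff b hb).le
    -- numerator: the deleted numerator is below `Z_Q(δ_x − δ_y)`
    have hnum : N ≤ Q.currentSum (Pi.single x 1 - Pi.single y 1) := by
      refine ENNReal.tsum_le_tsum fun J => ?_
      by_cases h : div J = Pi.single x 1 - Pi.single y 1 ∧ ∀ b ∈ D, J b = 0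
      · rw [if_pos h, if_pos h.1]
        have hw : Q.weight J = P.weight J := by
          unfold weight
          refine Finset.prod_congr rfl fun b _ => ?_
          by_cases hb : b ∈ D
          · rw [h.2 b hb, villainCurrentWeight_zero, villainCurrentWeight_zero]
          · rw [hoff b hb]
        rw [hw]
      · rw [if_neg h]
        exact bot_le
    -- denominator
    have hden : Q.currentSum 0 ≤ Z + ENNReal.ofReal (2 * ε * Real.exp (1 / (2 * κ₀))) * T :=
      P.currentSum_lowered_le Q D hε hεκ hκ₀ hoff hon 0
    -- monotonicity
    have hmono : Q.twoPoint x y ≤ a := Q.twoPoint_mono P hQP x y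
    have hQtp : N / (Z + ENNReal.ofReal (2 * ε * Real.exp (1 / (2 * κ₀))) * T) ≤ a := by
      refine le_trans ?_ hmono
      unfold twoPoint partitionFunction
      exact ENNReal.div_le_div hnum hden
    have hden0 : Z + ENNReal.ofReal (2 * ε * Real.exp (1 / (2 * κ₀))) * T ≠ 0 :=
      ne_of_gt (lt_of_lt_of_le (lt_of_lt_of_le one_pos hZ1) le_self_add)
    have hdentop : Z + ENNReal.ofReal (2 * ε * Real.exp (1 / (2 * κ₀))) * T ≠ ⊤ :=
      ENNReal.add_ne_top.2 ⟨hZtop, ENNReal.mul_ne_top ENNReal.ofReal_ne_top hT⟩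
    exact (ENNReal.div_le_iff_le_mul (Or.inl hden0) (Or.inl hdentop)).1 hQtp
  -- let `ε → 0⁺`
  have hNaZ : N ≤ a * Z := by
    refine ENNReal.le_of_forall_pos_le_add fun η hη _ => ?_
    -- choose `ε` with `a · (2ε e^{1/(2κ₀)}) · T ≤ η`
    set K : ℝ≥0∞ := a * (ENNReal.ofReal (2 * Real.exp (1 / (2 * κ₀))) * T) with hK
    have hKtop : K ≠ ⊤ := ENNReal.mul_ne_top ha' (ENNReal.mul_ne_top ENNReal.ofReal_ne_top hT)
    set ε : ℝ := min κ₀ ((η : ℝ) / (K.toReal + 1)) with hεdef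
    have hε : 0 < ε := lt_min hκ₀pos (div_pos (by exact_mod_cast hη) (by positivity))
    have hεκ : ε ≤ κ₀ := min_le_left _ _
    have hεη : ENNReal.ofReal ε * K ≤ η := by
      have hεle : ε ≤ (η : ℝ) / (K.toReal + 1) := min_le_right _ _
      have h1 : ENNReal.ofReal ε * K ≤ ENNReal.ofReal ((η : ℝ) / (K.toReal + 1)) * K :=
        mul_le_mul' (ENNReal.ofReal_le_ofReal hεle) le_rfl
      refine le_trans h1 ?_
      set k : ℝ := K.toReal with hkdef
      have hKr : 0 ≤ k := ENNReal.toReal_nonneg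
      have hKeq : K = ENNReal.ofReal k := (ENNReal.ofReal_toReal hKtop).symm
      rw [hKeq, ← ENNReal.ofReal_mul (by positivity)]
      have h2 : (η : ℝ) / (k + 1) * k ≤ η := by
        rw [div_mul_eq_mul_div, div_le_iff₀ (by positivity)]
        nlinarith [NNReal.coe_nonneg η]
      calc ENNReal.ofReal ((η : ℝ) / (k + 1) * k) ≤ ENNReal.ofReal (η : ℝ) :=
            ENNReal.ofReal_le_ofReal h2
        _ = η := ENNReal.ofReal_coe_nnreal
    have hk := key ε hε hεκ
    have hsplit : a * (Z + ENNReal.ofReal (2 * ε * Real.exp (1 / (2 * κ₀))) * T) =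
        a * Z + ENNReal.ofReal ε * K := by
      rw [hK, mul_add]
      congr 1
      rw [show 2 * ε * Real.exp (1 / (2 * κ₀)) = ε * (2 * Real.exp (1 / (2 * κ₀))) by ring,
        ENNReal.ofReal_mul hε.le]
      ring
    rw [hsplit] at hk
    exact le_trans hk (add_le_add le_rfl hεη)
  exact ENNReal.div_le_of_le_mul hNaZ

end VillainCurrentModel

end Literature.Probability.LatticeModels
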